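import Literature.AlgebraicGeometry.Frobenioids.ArchimedeanProp35iiToyBaseRC
import Literature.AlgebraicGeometry.Frobenioids.ArchimedeanQuasiIsotropic
import Literature.AlgebraicGeometry.Frobenioids.ArchimedeanPseudoTerminal
import HarnessLib

/-!
# Frobenioids II, Proposition 3.5 (ii) as typed for the ANGULAR Frobenioid `A` (`ArchFrd.Prop35ii_A`,
# FACT-LIST F-0861) and for `C` (`ArchFrd.Prop35ii_C`, F-0862): the universal closure over ALL bases
# `D → D₀` is FALSE — a COUNTEREXAMPLE over a base that is NOT totally epimorphic

Mochizuki, *The geometry of Frobenioids II: poly-Frobenioids*, Kyushu J. Math. **62** (2008) 401–460,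
§3, Proposition 3.5 (ii), kurims p. 34 [cite: MochizukiFrdII2008, Prop 3.5 (ii) p.34]: "The Frobenioid `F`
is quasi-isotropic, i.e., an object of `F` is non-isotropic if and only if it is an iso-subanchor of `F`" —
for `F = C = C₀ ×_{D₀} D` or `F = A` of Example 3.3 over a CONNECTED, TOTALLY EPIMORPHIC `D` (Ex. 3.3 (i),
p. 28) with a functor `D → D₀`, `D` of RC-iso-subanchor type; the direction «iso-subanchor ⇒ non-isotropic»
is [FrdI] Rmk. 3.1.1 [cite: MochizukiFrdI2008, Rmk. 3.1.1].

IN THE TREE: the typed instances `ArchFrd.Prop35ii_C π` / `ArchFrd.Prop35ii_A π` (abc-iut-L1-t9,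
`ArchimedeanTheoremsInstances.lean`) quantify over an ARBITRARY category `D` and functor `π : D → D₀`; they
are PROVED under the printed standing hypothesis (`ArchFrd.prop35ii_C (hTE : IsTotallyEpimorphic D)`,
`ArchFrd.prop35ii_A`, `ArchimedeanQuasiIsotropic.lean`, abc-iut-w4-d092) and outright at the base of
[IUTchI] Ex. 3.4 (i) (`prop35ii_C_ptBase`, `prop35ii_A_ptBase`, abc-iut-w4-d027). For `F = C` the universal
closure was refuted IN PARALLEL by abc-iut-w4-d092 over the two-object retract base `RB`
(`ArchFrd.not_prop35ii_C_retract`, `ArchFrd.exists_base_not_prop35ii_C`, `ArchimedeanProp35iiCounterexample.lean`);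
this file gives the twin for the ANGULAR Frobenioid `A` (new) together with an independent witness for `C`
over the three-object base `T` of `ArchimedeanProp35iiToyBase(RC).lean` (seat abc-iut-f-014, block F).

PROVED HERE. Base: `T` = finite `ℤ/2`-sets `c = ℤ/2` (free orbit), `p = pt`, `e = pt ⊔ pt` (connected, NOT
totally epimorphic, of RC-iso-subanchor type for the constant functor `toD0` at `Spec ℂ`,
`P35iiToy.isOfRCIsoSubanchorType_toD0`). With the unit ISOTROPIC objects `unitC x` / `unitA x` (tip-`1`
isotropic region over `Spec ℂ`) over `x ∈ {p, c, e}`: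

* `unitA p` (resp. `unitC p`) is an ANCHOR (`isAnchor_unitA_p`, `isAnchor_unit_p`): every arrow `(φ₀, g)`
  out of it factors as `(1, p → e) ≫ (φ₀, e → p → ·)` with NEITHER factor invertible (`p → e` and
  `e → p ≫ g` are not invertible in `T`; both factors are isometries when `(φ₀, g)` is), so NO arrow out of
  it is irreducible — whereas over a totally epimorphic base an isotropic object has infinitely many classes
  of irreducible prime-Frobenius arrows (`ArchFrd.A.not_isAnchor_of_isotropic`);
* `(1, c → p) : unitA c → unitA p` is a MONO-MINIMAL CATEGORICAL QUOTIENT by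
  `G := {γ ∈ Aut | γ_{C₀} = 1} ∋ σ_B := (1, σ)` (`exists_isMonoMinimalQuotient_unitA`, resp. `_unit`):
  `σ`-invariance of the `T`-part of a `G`-invariant arrow forces it to land over `p` or `e` and to factor
  uniquely through `c → p` (the `C₀`-parts are untouched since `toD0` is constant); a monomorphism `ζ` out
  of `unitA c` cannot land over `p` or `e` (`σ_B ≫ ζ = ζ`), and over `c` its `C₀`-part is a split
  monomorphism of the totally epimorphic `C₀` (`C0.isTotallyEpimorphic`), hence invertible;
* so `unitA p` is an isotropic ISO-SUBANCHOR of `A` (`isIsoSubanchor_unitA_p`): **`not_prop35ii_A`**,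
  **`not_forall_prop35ii_A`**, `exists_base_not_prop35ii_A`; likewise **`not_prop35ii_C`**,
  **`not_forall_prop35ii_C`** over the same base, and `not_prop35ii_C_and_not_prop35ii_A`.

READING. This is a statement about OUR typing (the schema omits the standing hypothesis "totally
epimorphic" of Ex. 3.3 (i)), not about the paper: it shows that hypothesis is NECESSARY for [FrdI]
Rmk. 3.1.1 at `A` and `C`, and that the FACT-LIST rows F-0861/F-0862 are admissible only in their instance /
conditional forms (`prop35ii_A/_C (hTE)`, `prop35ii_A/_C_ptBase`). No side is taken on [IUTchIII]
Cor. 3.12; typed ≠ proved except where a `theorem` says so.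
-/


namespace Literature.AlgebraicGeometry.Frobenioids

open CategoryTheory

noncomputable section

namespace ArchFrd

namespace P35iiToy

/-! ### The unit object over `p` is an anchor of `C` -/

/-- **No arrow out of the unit object over `p` is irreducible**: `(φ₀, g) = (1, p → e) ≫ (φ₀, e → p ≫ g)`
with neither factor invertible. [cite: MochizukiFrdI2008, §0 p.18] -/
theorem not_isIrreducibleHom_from_unit_p {Y : C toD0} (φ : unitC T.p ⟶ Y) : ¬ IsIrreducibleHom φ := by
  intro hφ
  obtain ⟨Y₀, y, ιY⟩ := Y
  have hfac : unitHom (T.sec false) ≫ (⟨φ.fst, T.ret ≫ φ.snd, φ.w⟩ : unitC T.e ⟶ ⟨Y₀, y, ιY⟩) = φ := by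
    refine CFP.hom_ext (Category.id_comp _) ?_
    change T.sec false ≫ T.ret ≫ φ.snd = φ.snd
    rw [← Category.assoc, T.sec_comp_ret, Category.id_comp]
  rcases hφ.2 _ _ hfac with hα | hβ
  · have hs : IsIso (T.ret ≫ φ.snd) :=
      @CFP.isIso_snd _ _ _ _ _ _ _ _ _ _ (⟨φ.fst, T.ret ≫ φ.snd, φ.w⟩ : unitC T.e ⟶ ⟨Y₀, y, ιY⟩) hα
    cases y with
    | c => exact (T.isEmpty_hom_pc.false φ.snd).elim
    | p =>
      rw [Subsingleton.elim (T.ret ≫ φ.snd) T.ret] at hs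
      exact T.not_isIso_ret hs
    | e =>
      obtain ⟨i, hi⟩ := T.hom_pe_eq φ.snd
      rw [hi, T.ret_comp_sec] at hs
      exact T.not_isIso_emap_const i hs
  · exact T.not_isIso_sec false (@CFP.isIso_snd _ _ _ _ _ _ _ _ _ _ (unitHom (T.sec false)) hβ)

/-- **The unit (isotropic) object over `p` is an ANCHOR of `C_{toD0}`** (vacuously: no irreducible arrow
leaves it). [cite: MochizukiFrdI2008, §0 p.18] -/
theorem isAnchor_unit_p : IsAnchor (unitC T.p) := by
  refine Set.Finite.subset Set.finite_empty ?_
  rintro x ⟨f, hf, -⟩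
  exact (not_isIrreducibleHom_from_unit_p f.hom hf).elim

/-! ### `(1, c → p) : unitC c → unitC p` is a mono-minimal categorical quotient -/

/-- **`(1, c → p)` is a MONO-MINIMAL CATEGORICAL QUOTIENT of the unit object over `c` by the group
`G = {γ ∈ Aut | γ_{C₀} = 1} ∋ σ_B`** (see the module docstring). [cite: MochizukiFrdI2008, §0 p.18] -/
theorem exists_isMonoMinimalQuotient_unit :
    ∃ G : Subgroup (Aut (unitC T.c)), swapC ∈ G ∧ IsMonoMinimalQuotient G (unitHom T.quot) := by
  refine ⟨{ carrier := {γ | γ.hom.fst = 𝟙 _}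
            one_mem' := rfl
            mul_mem' := fun {γ δ} hγ hδ => ?_
            inv_mem' := fun {γ} hγ => ?_ }, swapC_hom_fst, ⟨fun γ hγ => ?_, fun X ψ hψ => ?_⟩,
          fun A' ζ φ' hfac hmono _ => ?_⟩
  · change (δ.hom ≫ γ.hom).fst = 𝟙 _
    rw [CFP.comp_fst, show γ.hom.fst = 𝟙 _ from hγ, show δ.hom.fst = 𝟙 _ from hδ, Category.comp_id]
  · change γ.inv.fst = 𝟙 _
    have h : (γ.hom ≫ γ.inv).fst = 𝟙 _ := by rw [γ.hom_inv_id]; rfl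
    rwa [CFP.comp_fst, show γ.hom.fst = 𝟙 _ from hγ, Category.id_comp] at h
  · -- (a) `G`-invariance of `f`
    refine CFP.hom_ext ?_ (Subsingleton.elim _ _)
    rw [CFP.comp_fst, show γ.hom.fst = 𝟙 _ from hγ, Category.id_comp]
  · -- (b) unique factorisation of `G`-invariant arrows: their `T`-part is `σ`-invariant
    have hsw : T.sw ≫ ψ.snd = ψ.snd := congrArg CFP.Hom.snd (hψ swapC swapC_hom_fst)
    have hfst : ∀ ψ' : unitC T.p ⟶ X, unitHom T.quot ≫ ψ' = ψ → ψ'.fst = ψ.fst := fun ψ' h => by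
      have h1 := congrArg CFP.Hom.fst h
      rwa [CFP.comp_fst, Category.id_comp] at h1
    obtain ⟨X₀, x, ιX⟩ := X
    cases x with
    | c => exact (T.sw_comp_ne_self ψ.snd hsw).elim
    | p =>
      exact ⟨⟨ψ.fst, 𝟙 _, ψ.w⟩, CFP.hom_ext (Category.id_comp _) (Subsingleton.elim _ _),
        fun ψ' hψ' => CFP.hom_ext (hfst ψ' hψ') (Subsingleton.elim _ _)⟩
    | e =>
      obtain ⟨i, hi⟩ := T.hom_ce_eq ψ.snd
      refine ⟨⟨ψ.fst, T.sec i, ψ.w⟩, CFP.hom_ext (Category.id_comp _) ?_, fun ψ' hψ' => ?_⟩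
      · change T.quot ≫ T.sec i = ψ.snd
        rw [T.quot_comp_sec, hi]
      · refine CFP.hom_ext (hfst ψ' hψ') ?_
        obtain ⟨j, hj⟩ := T.hom_pe_eq ψ'.snd
        have h2 := congrArg CFP.Hom.snd hψ'
        change T.quot ≫ ψ'.snd = ψ.snd at h2
        rw [hj, T.quot_comp_sec, hi] at h2
        change ψ'.snd = T.sec i
        rw [hj, T.cst_injective h2]
  · -- mono-minimality: a mono out of `unitC c` lies over `c`, and then its `C₀`-part is invertible
    obtain ⟨A₀, a, ιA⟩ := A'
    have hσζ : swapC.hom ≫ ζ = 𝟙 _ ≫ ζ → False := fun h => swapC_hom_ne_id ((cancel_mono ζ).mp h)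
    have hfstζ : (swapC.hom ≫ ζ).fst = (𝟙 (unitC T.c) ≫ ζ).fst := by
      rw [CFP.comp_fst, CFP.comp_fst, swapC_hom_fst, CFP.id_fst]
    cases a with
    | c =>
      haveI : IsIso ζ.snd := T.isIso_hom_cc ζ.snd
      have h1 : ζ.fst ≫ φ'.fst = 𝟙 _ := congrArg CFP.Hom.fst hfac
      haveI : IsSplitMono ζ.fst := IsSplitMono.mk' ⟨φ'.fst, h1⟩
      haveI : Epi ζ.fst := C0.isTotallyEpimorphic.epi ζ.fst
      haveI : IsIso ζ.fst := isIso_of_epi_of_isSplitMono ζ.fst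
      exact CFP.isIso_of_isIso_fst_snd ζ
    | p => exact (hσζ (CFP.hom_ext hfstζ (Subsingleton.elim _ _))).elim
    | e =>
      refine (hσζ (CFP.hom_ext hfstζ ?_)).elim
      obtain ⟨i, hi⟩ := T.hom_ce_eq ζ.snd
      change T.sw ≫ ζ.snd = 𝟙 T.c ≫ ζ.snd
      rw [hi, T.sw_comp_cst, Category.id_comp]

/-- The unit object over `c` is a subanchor of `C` (it maps to the anchor over `p`).
[cite: MochizukiFrdI2008, §0 p.18] -/
theorem isSubanchor_unit_c : IsSubanchor (unitC T.c) :=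
  ⟨unitC T.p, isAnchor_unit_p, ⟨unitHom T.quot⟩⟩

/-- **The unit ISOTROPIC object over `p` is an ISO-SUBANCHOR of `C_{toD0}`.** [cite: MochizukiFrdI2008, §0 p.18] -/
theorem isIsoSubanchor_unit_p : IsIsoSubanchor (unitC T.p) := by
  obtain ⟨G, -, hG⟩ := exists_isMonoMinimalQuotient_unit
  exact ⟨unitC T.c, G, unitHom T.quot, isSubanchor_unit_c, hG⟩

/-! ### The refutation for `F = C` -/

/-- **[FrdII] Prop. 3.5 (ii) as typed FAILS for `C` over the (non-totally-epimorphic) toy base**: the unit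
object over `p` is isotropic AND an iso-subanchor. [cite: MochizukiFrdII2008, Prop 3.5 (ii) p.34] -/
theorem not_prop35ii_C : ¬ Literature.AlgebraicGeometry.Frobenioids.ArchFrd.Prop35ii_C toD0 := fun h =>
  (h isOfRCIsoSubanchorType_toD0 (unitC T.p)).2 isIsoSubanchor_unit_p (isIsotropic_unitC T.p)

/-- **The universal closure of `ArchFrd.Prop35ii_C` (FACT-LIST F-0862) is FALSE.**
[cite: MochizukiFrdII2008, Prop 3.5 (ii) p.34] -/
theorem not_forall_prop35ii_C :
    ¬ ∀ (D : Type) [Category.{0} D] (π : D ⥤ D0),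
      Literature.AlgebraicGeometry.Frobenioids.ArchFrd.Prop35ii_C π :=
  fun h => not_prop35ii_C (h T toD0)

/-- **Packaged witness for `C`**: a CONNECTED base `D → D₀` of RC-iso-subanchor type which is NOT totally
epimorphic and over which the typed Prop. 3.5 (ii) for `C` fails. [cite: MochizukiFrdII2008, Prop 3.5 (ii) p.34] -/
theorem exists_base_not_prop35ii_C :
    ∃ (D : Type) (_ : Category.{0} D) (π : D ⥤ D0), IsGraphConnected D ∧ ¬ IsTotallyEpimorphic D ∧
      RC.IsOfRCIsoSubanchorType (baseRC π) ∧
        ¬ Literature.AlgebraicGeometry.Frobenioids.ArchFrd.Prop35ii_C π :=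
  ⟨T, inferInstance, toD0, T.isGraphConnected, T.not_isTotallyEpimorphic, isOfRCIsoSubanchorType_toD0,
    not_prop35ii_C⟩

/-! ### The same counterexample in the angular Frobenioid `A ⊆ C` -/

/-- **No arrow of `A` out of the unit object over `p` is irreducible** (same factorisation; its factors
are isometries). [cite: MochizukiFrdI2008, §0 p.18] -/
theorem not_isIrreducibleHom_from_unitA_p {Y : A toD0} (φ : unitA T.p ⟶ Y) : ¬ IsIrreducibleHom φ := by
  intro hφ
  obtain ⟨⟨Y₀, y, ιY⟩⟩ := Y
  have hαiso : PreFrobenioid.IsIsometry (C.toElem toD0)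
      (⟨φ.hom.fst, T.ret ≫ φ.hom.snd, φ.hom.w⟩ : unitC T.e ⟶ ⟨Y₀, y, ιY⟩) :=
    (PreFrobenioid.isIsometry_fiberProduct_iff _).2
      ((PreFrobenioid.isIsometry_fiberProduct_iff _).1 φ.property)
  obtain ⟨α, hα1, hα2⟩ : ∃ α : unitA T.e ⟶ ⟨⟨Y₀, y, ιY⟩⟩,
      α.hom.fst = φ.hom.fst ∧ α.hom.snd = T.ret ≫ φ.hom.snd :=
    ⟨⟨⟨φ.hom.fst, T.ret ≫ φ.hom.snd, φ.hom.w⟩, hαiso⟩, rfl, rfl⟩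
  have hfac : unitHomA (T.sec false) ≫ α = φ := by
    apply WideSubcategory.hom_ext
    change unitHom (T.sec false) ≫ α.hom = φ.hom
    refine CFP.hom_ext ?_ ?_
    · rw [CFP.comp_fst, hα1]
      exact Category.id_comp _
    · rw [CFP.comp_snd, hα2]
      change T.sec false ≫ T.ret ≫ φ.hom.snd = φ.hom.snd
      rw [← Category.assoc, T.sec_comp_ret, Category.id_comp]
  rcases hφ.2 _ _ hfac with hα | hβ
  · haveI := hα
    haveI : IsIso α.hom := (inferInstance : IsIso ((A.ι toD0).map α))
    have hs : IsIso (T.ret ≫ φ.hom.snd) := hα2 ▸ CFP.isIso_snd α.hom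
    cases y with
    | c => exact (T.isEmpty_hom_pc.false φ.hom.snd).elim
    | p =>
      rw [Subsingleton.elim (T.ret ≫ φ.hom.snd) T.ret] at hs
      exact T.not_isIso_ret hs
    | e =>
      obtain ⟨i, hi⟩ := T.hom_pe_eq φ.hom.snd
      rw [hi, T.ret_comp_sec] at hs
      exact T.not_isIso_emap_const i hs
  · haveI := hβ
    haveI : IsIso (unitHomA (T.sec false)).hom := (inferInstance : IsIso ((A.ι toD0).map (unitHomA (T.sec false))))
    exact T.not_isIso_sec false (CFP.isIso_snd (unitHom (T.sec false)))

/-- **The unit (isotropic) object over `p` is an ANCHOR of `A`.** [cite: MochizukiFrdI2008, §0 p.18] -/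
theorem isAnchor_unitA_p : IsAnchor (unitA T.p) := by
  refine Set.Finite.subset Set.finite_empty ?_
  rintro x ⟨f, hf, -⟩
  exact (not_isIrreducibleHom_from_unitA_p f.hom hf).elim

/-- **`(1, c → p)` is a MONO-MINIMAL CATEGORICAL QUOTIENT in `A` of the unit object over `c` by
`G = {γ | γ_{C₀} = 1} ∋ σ_B`.** [cite: MochizukiFrdI2008, §0 p.18] -/
theorem exists_isMonoMinimalQuotient_unitA :
    ∃ G : Subgroup (Aut (unitA T.c)), swapA ∈ G ∧ IsMonoMinimalQuotient G (unitHomA T.quot) := by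
  refine ⟨{ carrier := {γ | γ.hom.hom.fst = 𝟙 _}
            one_mem' := rfl
            mul_mem' := fun {γ δ} hγ hδ => ?_
            inv_mem' := fun {γ} hγ => ?_ }, rfl, ⟨fun γ hγ => ?_, fun X ψ hψ => ?_⟩,
          fun A' ζ φ' hfac hmono _ => ?_⟩
  · change (δ.hom.hom ≫ γ.hom.hom).fst = 𝟙 _
    rw [CFP.comp_fst, show γ.hom.hom.fst = 𝟙 _ from hγ, show δ.hom.hom.fst = 𝟙 _ from hδ,
      Category.comp_id]
  · change γ.inv.hom.fst = 𝟙 _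
    have h : (γ.hom ≫ γ.inv).hom.fst = 𝟙 _ := by rw [γ.hom_inv_id]; rfl
    change (γ.hom.hom ≫ γ.inv.hom).fst = 𝟙 _ at h
    rwa [CFP.comp_fst, show γ.hom.hom.fst = 𝟙 _ from hγ, Category.id_comp] at h
  · -- (a) `G`-invariance
    apply WideSubcategory.hom_ext
    change γ.hom.hom ≫ unitHom T.quot = unitHom T.quot
    refine CFP.hom_ext ?_ (Subsingleton.elim _ _)
    rw [CFP.comp_fst, show γ.hom.hom.fst = 𝟙 _ from hγ, Category.id_comp]
  · -- (b) unique factorisation of `G`-invariant arrows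
    have hsw : T.sw ≫ ψ.hom.snd = ψ.hom.snd := congrArg (fun k => k.hom.snd) (hψ swapA rfl)
    have hfst : ∀ ψ' : unitA T.p ⟶ X, unitHomA T.quot ≫ ψ' = ψ → ψ'.hom.fst = ψ.hom.fst := fun ψ' h => by
      have h1 := congrArg (fun k => k.hom.fst) h
      change (unitHom T.quot ≫ ψ'.hom).fst = ψ.hom.fst at h1
      rwa [CFP.comp_fst, Category.id_comp] at h1
    obtain ⟨⟨X₀, x, ιX⟩⟩ := X
    have hψ'iso : ∀ (g : T.p ⟶ x)
        (w : (PreFrobenioid.baseFunctor C0.toElem).map ψ.hom.fst ≫ ιX.hom = (unitC T.p).iso.hom ≫ toD0.map g),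
        PreFrobenioid.IsIsometry (C.toElem toD0) (⟨ψ.hom.fst, g, w⟩ : unitC T.p ⟶ ⟨X₀, x, ιX⟩) :=
      fun g w => (PreFrobenioid.isIsometry_fiberProduct_iff _).2
        ((PreFrobenioid.isIsometry_fiberProduct_iff _).1 ψ.property)
    cases x with
    | c => exact (T.sw_comp_ne_self ψ.hom.snd hsw).elim
    | p =>
      refine ⟨⟨⟨ψ.hom.fst, 𝟙 _, ψ.hom.w⟩, hψ'iso _ _⟩, ?_, fun ψ' hψ' => ?_⟩
      · apply WideSubcategory.hom_ext
        change unitHom T.quot ≫ _ = ψ.hom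
        exact CFP.hom_ext (Category.id_comp _) (Subsingleton.elim _ _)
      · apply WideSubcategory.hom_ext
        exact CFP.hom_ext (hfst ψ' hψ') (Subsingleton.elim _ _)
    | e =>
      obtain ⟨i, hi⟩ := T.hom_ce_eq ψ.hom.snd
      refine ⟨⟨⟨ψ.hom.fst, T.sec i, ψ.hom.w⟩, hψ'iso _ _⟩, ?_, fun ψ' hψ' => ?_⟩
      · apply WideSubcategory.hom_ext
        change unitHom T.quot ≫ _ = ψ.hom
        refine CFP.hom_ext (Category.id_comp _) ?_
        change T.quot ≫ T.sec i = ψ.hom.snd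
        rw [T.quot_comp_sec, hi]
      · apply WideSubcategory.hom_ext
        refine CFP.hom_ext (hfst ψ' hψ') ?_
        obtain ⟨j, hj⟩ := T.hom_pe_eq ψ'.hom.snd
        have h2 := congrArg (fun k => k.hom.snd) hψ'
        change T.quot ≫ ψ'.hom.snd = ψ.hom.snd at h2
        rw [hj, T.quot_comp_sec, hi] at h2
        change ψ'.hom.snd = T.sec i
        rw [hj, T.cst_injective h2]
  · -- mono-minimality
    obtain ⟨⟨A₀, a, ιA⟩⟩ := A'
    have hσζ : swapA.hom ≫ ζ = 𝟙 _ ≫ ζ → False := fun h => swapA_hom_ne_id ((cancel_mono ζ).mp h)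
    have hfstζ : (swapA.hom.hom ≫ ζ.hom).fst = ((𝟙 (unitA T.c) : unitA T.c ⟶ unitA T.c).hom ≫ ζ.hom).fst := by
      rw [CFP.comp_fst, CFP.comp_fst]
      rfl
    cases a with
    | c =>
      haveI : IsIso ζ.hom.snd := T.isIso_hom_cc ζ.hom.snd
      have h1 : ζ.hom.fst ≫ φ'.hom.fst = 𝟙 _ := by
        have h := congrArg (fun k => k.hom.fst) hfac
        change (ζ.hom ≫ φ'.hom).fst = 𝟙 _ at h
        rwa [CFP.comp_fst] at h
      haveI : IsSplitMono ζ.hom.fst := IsSplitMono.mk' ⟨φ'.hom.fst, h1⟩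
      haveI : Epi ζ.hom.fst := C0.isTotallyEpimorphic.epi ζ.hom.fst
      haveI : IsIso ζ.hom.fst := isIso_of_epi_of_isSplitMono ζ.hom.fst
      haveI : IsIso ζ.hom := CFP.isIso_of_isIso_fst_snd ζ.hom
      exact A.isIso_of_isIso_hom ζ
    | p =>
      exact (hσζ (WideSubcategory.hom_ext _ (CFP.hom_ext hfstζ (Subsingleton.elim _ _)))).elim
    | e =>
      refine (hσζ (WideSubcategory.hom_ext _ (CFP.hom_ext hfstζ ?_))).elim
      obtain ⟨i, hi⟩ := T.hom_ce_eq ζ.hom.snd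
      change T.sw ≫ ζ.hom.snd = 𝟙 T.c ≫ ζ.hom.snd
      rw [hi, T.sw_comp_cst, Category.id_comp]

/-- The unit object over `c` is a subanchor of `A`. [cite: MochizukiFrdI2008, §0 p.18] -/
theorem isSubanchor_unitA_c : IsSubanchor (unitA T.c) :=
  ⟨unitA T.p, isAnchor_unitA_p, ⟨unitHomA T.quot⟩⟩

/-- **The unit ISOTROPIC object over `p` is an ISO-SUBANCHOR of `A`.** [cite: MochizukiFrdI2008, §0 p.18] -/
theorem isIsoSubanchor_unitA_p : IsIsoSubanchor (unitA T.p) := by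
  obtain ⟨G, -, hG⟩ := exists_isMonoMinimalQuotient_unitA
  exact ⟨unitA T.c, G, unitHomA T.quot, isSubanchor_unitA_c, hG⟩

/-- **[FrdII] Prop. 3.5 (ii) as typed FAILS for the angular Frobenioid `A` over the toy base.**
[cite: MochizukiFrdII2008, Prop 3.5 (ii) p.34] -/
theorem not_prop35ii_A : ¬ Literature.AlgebraicGeometry.Frobenioids.ArchFrd.Prop35ii_A toD0 := fun h =>
  (h isOfRCIsoSubanchorType_toD0 (unitA T.p)).2 isIsoSubanchor_unitA_p (isIsotropic_unitA T.p)

/-- **The universal closure of `ArchFrd.Prop35ii_A` (FACT-LIST F-0861) is FALSE.**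
[cite: MochizukiFrdII2008, Prop 3.5 (ii) p.34] -/
theorem not_forall_prop35ii_A :
    ¬ ∀ (D : Type) [Category.{0} D] (π : D ⥤ D0),
      Literature.AlgebraicGeometry.Frobenioids.ArchFrd.Prop35ii_A π :=
  fun h => not_prop35ii_A (h T toD0)

/-- **Packaged witness for `A`**: a connected base of RC-iso-subanchor type which is NOT totally
epimorphic and over which the typed Prop. 3.5 (ii) for `A` fails. [cite: MochizukiFrdII2008, Prop 3.5 (ii) p.34] -/
theorem exists_base_not_prop35ii_A :
    ∃ (D : Type) (_ : Category.{0} D) (π : D ⥤ D0), IsGraphConnected D ∧ ¬ IsTotallyEpimorphic D ∧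
      RC.IsOfRCIsoSubanchorType (baseRC π) ∧
        ¬ Literature.AlgebraicGeometry.Frobenioids.ArchFrd.Prop35ii_A π :=
  ⟨T, inferInstance, toD0, T.isGraphConnected, T.not_isTotallyEpimorphic, isOfRCIsoSubanchorType_toD0,
    not_prop35ii_A⟩

/-- **Both typed instances of [FrdII] Prop. 3.5 (ii) need the printed standing hypothesis**: over the toy
base neither `Prop35ii_C` nor `Prop35ii_A` holds, although `D` is connected and of RC-iso-subanchor type.
[cite: MochizukiFrdII2008, Prop 3.5 (ii) p.34] -/
theorem not_prop35ii_C_and_not_prop35ii_A :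
    ¬ Literature.AlgebraicGeometry.Frobenioids.ArchFrd.Prop35ii_C toD0 ∧
      ¬ Literature.AlgebraicGeometry.Frobenioids.ArchFrd.Prop35ii_A toD0 :=
  ⟨not_prop35ii_C, not_prop35ii_A⟩

end P35iiToy

end ArchFrd

end

end Literature.AlgebraicGeometry.Frobenioids
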